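import Summits.Ventures.LatticeQCDFlow.Scoring.SU2TorusPlaquetteFiniteVolume
import HarnessLib

/-!
# SU(2) on the 2-torus: the thermodynamic limit of the plaquette is the one-plaquette value `I₂(2β)/I₁(2β)`

HONEST FRAMING: exact (Metropolis-corrected) sampling algorithms for lattice gauge theory;
figures of merit are autocorrelation/cost numbers at stated couplings and volumes; no
continuum-physics claim.

Venture `LatticeQCDFlow` (cell pub-lqcd), sub-topic `Scoring`; FANOUT row 5 (`s0-sun-a`), GEN-10.
NEW WORK of the cell (placement rule).  A corollary of the exponential finite-volume bound
`SU2TorusPlaquetteFiniteVolume.abs_wilson_mean_su2a0_plaquette_two_sub_le`: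

* **`tendsto_wilson_mean_su2a0_plaquette_two`** — for `β > 0`, as `L → ∞` the exact plaquette
  `⟨½ tr U_p⟩_{(ℤ/L)²,β}` of theory-2's SU(2) Wilson measure on the `L × L` torus converges to
  `I₂(2β)/I₁(2β)` — the infinite-volume 2-d SU(2) plaquette (Gross–Witten / the cell's reference
  one-plaquette table at `b = 2β`), since `I₂(2β) < I₁(2β)`.

Elementary; nothing is cited; no `def`.
-/

noncomputable section

open Real MeasureTheory Set Function Finset Filter Topology Polynomial.Chebyshev
open Literature.MathematicalPhysics.QuantumFieldTheory Literature.MathematicalPhysics.QuantumLattice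
open Literature.Analysis.FunctionSpaces
open Summit.Ventures.LatticeQCDFlow.Exactness
open Summit.Ventures.LatticeQCDFlow.Theory2.Lattice

namespace Summit.Ventures.LatticeQCDFlow.Scoring

/-- `0 ≤ I₂(2β)/I₁(2β) < 1` for `β > 0`. -/
theorem besselI_two_div_one_lt_one {β : ℝ} (hβ : 0 < β) :
    0 ≤ besselI 2 (2 * β) / besselI 1 (2 * β) ∧ besselI 2 (2 * β) / besselI 1 (2 * β) < 1 := by
  have hx : (0 : ℝ) < 2 * β := by linarith
  have hI1 : 0 < besselI 1 (2 * β) := besselI_pos 1 hx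
  refine ⟨div_nonneg (besselI_nonneg 2 hx.le) hI1.le, (div_lt_one hI1).mpr ?_⟩
  exact besselI_succ_lt 1 hx

/-- **THE THERMODYNAMIC LIMIT OF THE SU(2) TORUS PLAQUETTE.**  For `β > 0`,
`⟨½ tr U_p⟩_{(ℤ/(L+1))²,β} → I₂(2β)/I₁(2β)` as `L → ∞` (plaquette at the origin; by translation
invariance of the statement's proof the site is immaterial — every site satisfies the same bound). -/
theorem tendsto_wilson_mean_su2a0_plaquette_two {β : ℝ} (hβ : 0 < β) :
    Tendsto (fun L : ℕ => ∫ V, su2a0 (plaquetteHolonomy V (0 : Site 2 (L + 1)) 0 1)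
        ∂(wilsonMeasure (d := 2) (L := L + 1) (fundamentalRep (Fin 2)) β))
      atTop (𝓝 (besselI 2 (2 * β) / besselI 1 (2 * β))) := by
  obtain ⟨hr0, hr1⟩ := besselI_two_div_one_lt_one hβ
  set r : ℝ := besselI 2 (2 * β) / besselI 1 (2 * β) with hr
  set K : ℝ := 1 / 4 + 5 / 2 * (∑' n : ℕ, besselI (n + 2) (2 * β)) / besselI 1 (2 * β) with hK
  -- the bound `K · r^{(L+1)² − 1} → 0`
  have hexp : Tendsto (fun L : ℕ => (L + 1) ^ 2 - 1) atTop atTop := by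
    refine tendsto_atTop_mono (fun L => ?_) tendsto_id
    have : (L + 1) ^ 2 = L * L + 2 * L + 1 := by ring
    simp only [id_eq]
    omega
  have hpow : Tendsto (fun L : ℕ => r ^ ((L + 1) ^ 2 - 1)) atTop (𝓝 0) :=
    (tendsto_pow_atTop_nhds_zero_of_lt_one hr0 hr1).comp hexp
  have hbound : Tendsto (fun L : ℕ => r ^ ((L + 1) ^ 2 - 1) * K) atTop (𝓝 0) := by
    simpa using hpow.mul_const K
  rw [tendsto_iff_norm_sub_tendsto_zero]
  refine squeeze_zero (fun L => norm_nonneg _) (fun L => ?_) hbound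
  rw [Real.norm_eq_abs]
  exact abs_wilson_mean_su2a0_plaquette_two_sub_le (L := L + 1) hβ 0

end Summit.Ventures.LatticeQCDFlow.Scoring
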